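import Literature.AlgebraicGeometry.Resolution.CharPolyhedronOriginChart
import HarnessLib

/-!
# The monic transform `h'(Z') = u_{j₀}^{-m} h(u_{j₀} Z')` of the origin chart exists (Cossart–Piltant 2019, (2.7))

Topic: `Literature/AlgebraicGeometry/Resolution`, continuing `CharPolyhedronOriginChart.lean` (Prop. 2.6 of
V. Cossart, O. Piltant, *Resolution of singularities of arithmetical threefolds*, J. Algebra 529 (2019) = arXiv:1412.0868,
v1 pp. 13–14). That file proves, for ABSTRACT chart data `ψ : S → S'`, `u`, `u'`, `j₀ ∈ J`, and for ANY monic `h'` whose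
coefficients satisfy `f_{i,Z'} · u'_{j₀}^i = ψ(f_{i,Z})` ((2.7): `h'(Z') := u_{j₀}^{-m} h(u_{j₀} Z')`), that minimality of
`Δ_S(h; u; Z)` passes to `Δ_{S'}(h'; u'; Z')` (`CossartPiltant.isMinimal_map_of_isMinimal`). Here we PROVE that such an
`h'` EXISTS as soon as `f_{i,Z} ∈ I_J^i` for `1 ≤ i ≤ m` — the hypothesis «`δ(y) ≥ 1`», i.e. `V(Z, u_J)` is an
equimultiple centre of the hypersurface `h = 0` — because `ψ(I_J) ⊆ (u'_{j₀})` on the `j₀`-chart: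

* `CossartPiltant.map_pow_span_image_le_span_singleton_pow` — `ψ(I_J^i) ⊆ (u'_{j₀}^i)`;
* `CossartPiltant.exists_monic_originChart` — **existence of `h'`**: monic, `deg h' = deg h = m`, and
  `h'.coeff (m - i) * u' j₀ ^ i = ψ (h.coeff (m - i))` for `1 ≤ i ≤ m` (the `hcoef` hypothesis of that file);
* `CossartPiltant.exists_monic_isMinimal_originChart` — packaged with Prop. 2.6: if moreover `Δ_S(h; u; Z)` is minimal
  (and the standing hypotheses of `isMinimal_map_of_isMinimal` hold), some such `h'` has `Δ_{S'}(h'; u'; Z')` minimal.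

Everything is PROVED; no definitions, no named facts. Motivation (index only): cell `res-hironaka`, L W4.2, object D18
«hypersurface propagation of CP frames» — the transform of a Cossart–Piltant frame `(R, u, h)` at the origin of a
blow-up chart is `(R', u', h')` with THIS `h'`.

## Sources
* V. Cossart, O. Piltant, J. Algebra 529 (2019), Prop. 2.6 and (2.7) (arXiv v1 pp. 13–14). [CossartPiltant2019]
-/

open Finset IsLocalRing Polynomial

namespace Literature.AlgebraicGeometry.Resolution.CossartPiltant

universe u v

variable {S : Type u} [CommRing S] {S' : Type v} [CommRing S'] {n : ℕ}

/-- On the `j₀`-chart, `ψ(I_J) ⊆ (u'_{j₀})`, hence **`ψ(I_J^i) ⊆ (u'_{j₀}^i)`** (`I_J = (u_j : j ∈ J)`;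
`ψ(u_j) = u'_{j₀} u'_j` for `j ∈ J ∖ {j₀}` and `ψ(u_{j₀}) = u'_{j₀}`). [cite: CossartPiltant2019, Prop. 2.6 (arXiv v1 p. 13)] -/
theorem map_pow_span_image_le_span_singleton_pow (ψ : S →+* S') (u : Fin n → S) (u' : Fin n → S')
    {J : Finset (Fin n)} {j₀ : Fin n}
    (hrel : ∀ j, ψ (u j) = if j ∈ J ∧ j ≠ j₀ then u' j₀ * u' j else u' j) (i : ℕ) :
    (Ideal.span (u '' ↑J) ^ i).map ψ ≤ Ideal.span {u' j₀ ^ i} := by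
  rw [Ideal.map_pow, ← Ideal.span_singleton_pow]
  refine Ideal.pow_right_mono ?_ i
  rw [Ideal.map_span, Ideal.span_le]
  rintro _ ⟨_, ⟨j, hj, rfl⟩, rfl⟩
  rw [SetLike.mem_coe, Ideal.mem_span_singleton, hrel j]
  by_cases hjj : j = j₀
  · subst hjj
    rw [if_neg (fun h => h.2 rfl)]
  · rw [if_pos ⟨Finset.mem_coe.mp hj, hjj⟩]
    exact Dvd.intro _ rfl

/-- **Existence of the monic transform `h'(Z') = u_{j₀}^{-m} h(u_{j₀} Z')` of (2.7).** If `h ∈ S[Z]` has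
degree `m` (monic or not) with `f_{i,Z} = h.coeff (m - i) ∈ I_J^i` for `1 ≤ i ≤ m` («`δ(y) ≥ 1`»), then on the `j₀`-chart there is a
monic `h' ∈ S'[Z']` of degree `m` with `h'.coeff (m - i) · u'_{j₀}^i = ψ(h.coeff (m - i))` for `1 ≤ i ≤ m`.
[cite: CossartPiltant2019, (2.7) and Prop. 2.6 (arXiv v1 pp. 13–14)] -/
theorem exists_monic_originChart [Nontrivial S'] (ψ : S →+* S') (u : Fin n → S) (u' : Fin n → S')
    {J : Finset (Fin n)} {j₀ : Fin n}
    (hrel : ∀ j, ψ (u j) = if j ∈ J ∧ j ≠ j₀ then u' j₀ * u' j else u' j) {h : S[X]}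
    (hI : ∀ i ∈ Finset.Icc 1 h.natDegree, h.coeff (h.natDegree - i) ∈ Ideal.span (u '' ↑J) ^ i) :
    ∃ h' : S'[X], h'.Monic ∧ h'.natDegree = h.natDegree ∧
      ∀ i ∈ Finset.Icc 1 h.natDegree, h'.coeff (h.natDegree - i) * u' j₀ ^ i = ψ (h.coeff (h.natDegree - i)) := by
  classical
  set m := h.natDegree with hm
  -- choose the divided coefficients `c k`, `k < m`: `c k * u'_{j₀}^(m-k) = ψ (h.coeff k)`
  have hdiv : ∀ k, k < m → ∃ c : S', c * u' j₀ ^ (m - k) = ψ (h.coeff k) := by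
    intro k hk
    have hmem : ψ (h.coeff k) ∈ Ideal.span {u' j₀ ^ (m - k)} := by
      refine map_pow_span_image_le_span_singleton_pow ψ u u' hrel (m - k) (Ideal.mem_map_of_mem ψ ?_)
      have := hI (m - k) (Finset.mem_Icc.mpr ⟨by omega, by omega⟩)
      rwa [show m - (m - k) = k by omega] at this
    exact Ideal.mem_span_singleton'.mp hmem
  choose! c hc using hdiv
  have hlt : (∑ k ∈ Finset.range m, C (c k) * X ^ k).degree < (m : WithBot ℕ) := by
    refine (degree_sum_le _ _).trans_lt ((Finset.sup_lt_iff (WithBot.bot_lt_coe m)).mpr fun k hk => ?_)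
    exact (degree_C_mul_X_pow_le k (c k)).trans_lt (WithBot.coe_lt_coe.mpr (Finset.mem_range.mp hk))
  refine ⟨X ^ m + ∑ k ∈ Finset.range m, C (c k) * X ^ k, monic_X_pow_add hlt, ?_, ?_⟩
  · rw [natDegree_add_eq_left_of_degree_lt (by rwa [degree_X_pow]), natDegree_X_pow]
  · intro i hi
    obtain ⟨hi1, him⟩ := Finset.mem_Icc.mp hi
    have hk : m - i < m := by omega
    rw [coeff_add, coeff_X_pow, if_neg (by omega), zero_add, finsetSum_coeff]
    simp only [coeff_C_mul_X_pow]
    rw [Finset.sum_ite_eq (Finset.range m) (m - i) c, if_pos (Finset.mem_range.mpr hk)]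
    have := hc (m - i) hk
    rwa [show m - (m - i) = i by omega] at this

section OriginChart

variable [IsNoetherianRing S] [IsLocalRing S]
  (ψ : S →+* S') (u : Fin n → S) (u' : Fin n → S')
  (H : ∀ (i : Fin n) (T : Finset (Fin n)), i ∉ T →
    ∀ y, u i * y ∈ Ideal.span (u '' ↑T) → y ∈ Ideal.span (u '' ↑T))
  (hu : ∀ i, u i ∈ maximalIdeal S)
  (H' : ∀ (i : Fin n) (T : Finset (Fin n)), i ∉ T →
    ∀ y, u' i * y ∈ Ideal.span (u' '' ↑T) → y ∈ Ideal.span (u' '' ↑T))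
  {J : Finset (Fin n)} {j₀ : Fin n} (hj₀ : j₀ ∈ J) (hnzd : ∀ y : S', u' j₀ * y = 0 → y = 0)
  (hrel : ∀ j, ψ (u j) = if j ∈ J ∧ j ≠ j₀ then u' j₀ * u' j else u' j)
  (hψ : ∀ γ : S, ψ γ ∈ Ideal.span (Set.range u') → γ ∈ Ideal.span (Set.range u))

include H hu H' hj₀ hnzd hrel hψ

/-- **Prop. 2.6 with the transform constructed**: under the standing hypotheses of the origin chart, for `h ∈ S[Z]`
of degree `m` with `f_{i,Z} ∈ I_J^i` and `i ≤ Σ_{j ∈ J} a_j` on the minimal exponents, there is a monic `h' ∈ S'[Z']` of the same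
degree, with the coefficient relation (2.7), whose polyhedron `Δ_{S'}(h'; u'; Z')` is minimal whenever `Δ_S(h; u; Z)` is
(and `S/(u) → S'/(u')` is onto). [cite: CossartPiltant2019, Prop. 2.6 (arXiv v1 pp. 13–14)] -/
theorem exists_monic_isMinimal_originChart [Nontrivial S'] {h : S[X]}
    (hI : ∀ i ∈ Finset.Icc 1 h.natDegree, h.coeff (h.natDegree - i) ∈ Ideal.span (u '' ↑J) ^ i)
    (hIJ : ∀ i ∈ Finset.Icc 1 h.natDegree, ∀ a ∈ minExponents u (h.coeff (h.natDegree - i)), i ≤ ∑ j ∈ J, a j)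
    (hsurj : ∀ s' : S', ∃ s : S, ψ s - s' ∈ Ideal.span (Set.range u')) :
    ∃ h' : S'[X], h'.Monic ∧ h'.natDegree = h.natDegree ∧
      (∀ i ∈ Finset.Icc 1 h.natDegree, h'.coeff (h.natDegree - i) * u' j₀ ^ i = ψ (h.coeff (h.natDegree - i))) ∧
      (IsMinimal u h → IsMinimal u' h') := by
  obtain ⟨h', hmon', hdeg, hcoef⟩ := exists_monic_originChart ψ u u' hrel hI
  exact ⟨h', hmon', hdeg, hcoef, fun hmin =>
    isMinimal_map_of_isMinimal ψ u u' H hu H' hj₀ hnzd hrel hψ hdeg hcoef hIJ hsurj hmin⟩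

end OriginChart

end Literature.AlgebraicGeometry.Resolution.CossartPiltant
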